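import Literature.NumberTheory.ComplexMultiplication.TateHypEllPowerTowerOfCMPower
import Summits.HodgeConjecture.HodgeConjecture.Theorems.HCCMUnconditionalShimuraThm18_6Holds
import HarnessLib

/-!
# T5 §6.5 — Tate's hypothesis along `ℓ`-power towers for POWERS of CM elliptic structures, UNCONDITIONALLY

Cell hodgecm-mathlib, fan A, binder hLiu418 (item stmt-HodgeConjecture-24832), sub-skeleton
`Cruxes/HLiu418/Lines/faltings_isogeny.lean` (row VI-1 [Fal83 §5 Kor. 1] re-keyed on Tate's
hypothesis along `ℓ`-power towers `AbelianVariety.tateHypEllPowerTower`; FALTINGS-SPEC §6.5 «rank-r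
edition», witness ledger §9).  The Literature head
`Literature.NumberTheory.ComplexMultiplication.tateHypEllPowerTower_pow_of_CM_elliptic_of_thm18_6`
proves, granted the named fact `shimura1998_thm18_6` ([Shimura 1998, Thm. 18.6]), that for every
structure `(A₀, ι₀ : 𝓞_K → End A₀)` of CM type `(K, Φ)` over a field `k` with `k → ℂ`
(`IsCMTypeRealisationOver`; the conclusion `tateHypEllPowerTower` itself quantifies over
`[NumberField k]`) with `[K : ℚ] = 2`, every `r` and every prime `ℓ`, Tate's hypothesis holds for the power
`⨁_{Fin r} A₀ = A₀ʳ`; that fact is a THEOREM of the tree Summits-side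
(`Theorems.shimura1998_thm18_6_holds`, row II-1), so here the statement is closed with NO hypothesis
— a decided instance-family of the residual citation `stub_hypEllPowerTower` of the VI-1 line outside
dimension one (rank-`r` Steinitz / Jordan–Zassenhaus pigeonhole over `𝓞_K`,
`Literature/Algebra/Module/DedekindLatticeIsoClasses`; witness rung; no floor change).

HC_CM is proved only modulo the printed citations of the floor until rung 0 closes; this file moves
no floor binder.
-/

-- mandated namespace `Summit.HodgeConjecture.HodgeConjecture.Theorems` trips `linter.dupNamespace` (single-problem
-- summit); off as in `HCCMUnconditionalShimuraThm18_6Holds.lean`.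
set_option linter.dupNamespace false

open CategoryTheory CategoryTheory.Limits NumberField
open scoped NumberField

namespace Summit.HodgeConjecture.HodgeConjecture.Theorems

open Literature.AlgebraicGeometry.Motives
open Literature.NumberTheory.ComplexMultiplication

/-- **Tate's finiteness hypothesis along `ℓ`-power towers for every power of a CM elliptic structure,
unconditionally** (Tate 1966 §2 Hyp(k, A, ℓ) decided for `A = A₀ʳ`, `(A₀, ι₀)` of CM type `(K, Φ)`
over a field `k → ℂ`, `[K : ℚ] = 2`; the predicate quantifies over `[NumberField k]`): the Literature head
`tateHypEllPowerTower_pow_of_CM_elliptic_of_thm18_6` (Shimura–Taniyama Frobenius at a degree-one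
place, bounded stabiliser index, Steinitz-splitting / shape pigeonhole for lattices in
`(ℤ_ℓ ⊗ 𝓞_K)ʳ`, realising matrix endomorphism) fed with the tree's theorem
`shimura1998_thm18_6_holds` ([Shimura 1998, Thm. 18.6], row II-1).
[cite: Tate1966Endomorphisms, §2 pp. 136–137] [cite: Shimura1998, §18.6 Theorem 18.6; §7.4 Propositions 15 and 17] -/
theorem tateHypEllPowerTower_pow_of_CM_elliptic :
    ∀ {k : Type} [Field k] [Algebra k ℂ] {K : Type} [Field K] [NumberField K]
      [IsCMField K] (Φ : CMType K) (A₀ : AbelianVariety k) (ι₀ : 𝓞 K →+* End A₀),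
      IsCMTypeRealisationOver Φ A₀ ι₀ → Module.finrank ℚ K = 2 →
      ∀ (r ℓ : ℕ) [Fact ℓ.Prime], (⨁ fun _ : Fin r => A₀).tateHypEllPowerTower ℓ :=
  Literature.NumberTheory.ComplexMultiplication.tateHypEllPowerTower_pow_of_CM_elliptic_of_thm18_6
    shimura1998_thm18_6_holds

end Summit.HodgeConjecture.HodgeConjecture.Theorems
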